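import Summits.CriticalPhenomena.PercolationContinuityZ3.Theorems.PercNearOneGluingAdditiveGluingOffClusterAssociation
import HarnessLib

/-!
# A four-term transfer inequality of van den Berg–Häggström–Kahn type — the engine for Kozma–Nitzan's Questions 8/9
# with an arbitrary avoided set for the observer

Support file for the (closed) crux `PercNearOneGluingNoHeavy.NoHeavyLowerTail` (stmt-CriticalPhenomena-4575), factory
seat `prim-ineq-gen-6` (gen 12).  No definitions, no named facts, no sorries; standard axioms.

Kozma–Nitzan (arXiv:2401.12397, §5.5 p. 36) ask whether the pre-FKG inequality (41)
`P(0 ↔ b, 0 ↔ A) ≥ P(0 ↔ A, a ↔ b)` holds for the relay `a ∈ A` minimising `P(a ↔ b, 0 ↮ A)` (QUESTION 8) resp.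
minimising `P_H(a ↔ b)`, `H = G` minus the edges of `0` (QUESTION 9).  Both scores are of the form `P(a ↔ b, F)` for a
DECREASING event `F` of the cluster of `0` contained in `{0 ↮ A}`: `F = {0 ↮ A}` for Question 8, `F = {C(0) = {0}}` for
Question 9, and in between `F = {0 ↮ Z}` for any vertex set `Z ⊇ A`.  Exhaustive exact census of this seat (all connected
graphs on `n ≤ 6` vertices, two weight families, `|A| ≤ 4`; memo prim-ineq-gen-6/FINDING-G12.md): the designation by
`P(a ↔ b, 0 ↮ Z)` satisfies (41) for EVERY `Z ⊇ A` (0 violations / 1.9·10⁵ designated instances in which some relay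
violates (41)), while avoided sets `Z ⊉ A` fail at `|A| ≥ 3` (e.g. `Z = {a}`: an exact violation of margin
`−795767/3125000000` on 6 vertices).

THIS FILE is the engine of the two-relay case (file `…KnQuestion8Spectators.lean`):

* `KnQ8Z.ratio_transfer` — **the four-term transfer inequality.**  `μ = prodBernoulli w`, a vertex `s`, a set `X ∌ s`,
  `D = {s ↮ X}`; `Q`, `A'` events that are decreasing in `C_s` and increasing in the configuration off `C̄_s`, and `B`,
  `F` events increasing in `C_s` and decreasing off `C̄_s` (all read as predicates of `(C_s, ω ∖ C̄_s)`).  Then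
  `μ(D ∩ Q ∩ B) · μ(D ∩ F ∩ A') ≤ μ(D ∩ Q ∩ A') · μ(D ∩ F ∩ B)`.
  (Four applications of the off-cluster association of `…AdditiveGluingOffClusterAssociation.lean` = BHK 2006 Thm 1.5 given
  `{s ↮ X}`: `Cov(Q,B) ≤ 0`, `Cov(Q,A') ≥ 0`, `Cov(F,B) ≥ 0`, `Cov(F,A') ≤ 0` on `D`, multiplied and cancelled.)
  prim-lf-2's transfer lemma `KnQ8.transfer_across` is the case `F = Qᶜ`; the point of the general `F` is that a
  comparison `μ(D ∩ F ∩ B) ≤ μ(D ∩ F ∩ A')` on ANY decreasing event `F` of the off-cluster configuration transfers to `Q`.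
* `KnQ8Z.ratio_transfer_conn` / `ratio_transfer_avoid` / `ratio_transfer_offDecreasing` — the instance `s = c` (a relay),
  `X ∋ o`, `Q = {o ↔ a}`, `A' = {a ↔ b} ∩ {a ↮ c}`, `B = {c ↔ b}`, and `F = {Φ(ω ∖ C̄_c)}` for a decreasing `Φ`, in
  particular `F = {o ↮ Z}`:  `μ(D, o↔a, c↔b) · μ(D, o↮Z, a↔b, a↮c) ≤ μ(D, o↔a, a↔b, a↮c) · μ(D, o↮Z, c↔b)`.
[cite: VandenbergHaggstromKahn2005, Thms. 1.3–1.5 (pp. 6–8)] [cite: KozmaNitzan2024, Questions 8–9 (§5.5 p. 36); Lemma 3 (pp. 6–7)]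
-/

noncomputable section

namespace Summit.CriticalPhenomena.PercolationContinuityZ3.Theorems

open MeasureTheory Set
open Literature.Probability.LatticeModels (prodBernoulli)
open Literature.Probability.Percolation
open Literature.Probability.Percolation.BHK2006 (openGraph_le)
open Summit.CriticalPhenomena.PercolationContinuityZ3.Cruxes.AdditiveGluing.TieLine
open scoped Classical

namespace KnQ8Z

variable {V : Type*} [Fintype V]

/-- `D⟦s, X⟧ = {s ↮ X}` (source abbreviation of `{ω | ∀ x ∈ X, ¬ (openGraph ω).Reachable s x}`). -/
local notation3 (prettyPrint := false) "D⟦" s ", " X "⟧" =>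
  {ω : BondConfig V | ∀ x ∈ X, ¬ (openGraph ω).Reachable s x}

/-- `B⟦W, s⟧ = W̄`, the pairs meeting `{s} ∪ V(W)` (source abbreviation, as in the off-cluster file). -/
local notation3 (prettyPrint := false) "B⟦" W ", " s "⟧" => {e : Sym2 V | ∃ v ∈ e, v = s ∨ ∃ e' ∈ W, v ∈ e'}

/-! ### The four-term transfer inequality -/

/-- **Event form, two cluster-increasing / off-decreasing events are positively correlated given `D = {s ↮ X}`**:
for predicates `P, Q` of `(C_s, ω ∖ C̄_s)` increasing in `C_s` and decreasing off `C̄_s`,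
`μ(D ∩ {P}) μ(D ∩ {Q}) ≤ μ(D) μ(D ∩ {P} ∩ {Q})` (the off-cluster association `OffCluster.offClusterAssoc` for indicators).
[cite: VandenbergHaggstromKahn2005, Thm. 1.3 (p. 6), Thm. 1.5 (p. 7)] -/
theorem offCluster_event_posAssoc_cluster (w : Sym2 V → unitInterval) (s : V) (X : Set V) (hs : s ∉ X)
    (P Q : Set (Sym2 V) → Set (Sym2 V) → Prop)
    (hP1 : ∀ ⦃C C'⦄ (E), C ⊆ C' → P C E → P C' E) (hP2 : ∀ (C) ⦃E E'⦄, E ⊆ E' → P C E' → P C E)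
    (hQ1 : ∀ ⦃C C'⦄ (E), C ⊆ C' → Q C E → Q C' E) (hQ2 : ∀ (C) ⦃E E'⦄, E ⊆ E' → Q C E' → Q C E) :
    (prodBernoulli w).real (D⟦s, X⟧ ∩ {ω | P (openEdgeCluster ω s) (ω \ B⟦openEdgeCluster ω s, s⟧)}) *
      (prodBernoulli w).real (D⟦s, X⟧ ∩ {ω | Q (openEdgeCluster ω s) (ω \ B⟦openEdgeCluster ω s, s⟧)}) ≤
    (prodBernoulli w).real D⟦s, X⟧ * (prodBernoulli w).real (D⟦s, X⟧ ∩
      ({ω | P (openEdgeCluster ω s) (ω \ B⟦openEdgeCluster ω s, s⟧)} ∩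
       {ω | Q (openEdgeCluster ω s) (ω \ B⟦openEdgeCluster ω s, s⟧)})) := by
  have key := OffCluster.offClusterAssoc w s X hs
    (fun C E => if P C E then (1 : ℝ) else 0) (fun C E => if Q C E then (1 : ℝ) else 0)
    (fun E => OffCluster.monotone_ite fun _ _ h h' => hP1 E h h')
    (fun C => OffCluster.antitone_ite fun _ _ h h' => hP2 C h h')
    (fun E => OffCluster.monotone_ite fun _ _ h h' => hQ1 E h h')
    (fun C => OffCluster.antitone_ite fun _ _ h h' => hQ2 C h h')
  simp only [OffCluster.ite_one_mul_ite_one] at key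
  rw [OffCluster.setIntegral_ite_eq, OffCluster.setIntegral_ite_eq, OffCluster.setIntegral_ite_eq] at key
  exact key

/-- Cancellation step of the transfer: from the four correlation inequalities (in product form, `d = μ(D)`)
`d·qb ≤ q·b`, `q·a ≤ d·qa`, `f·b ≤ d·fb`, `d·fa ≤ a·f` with `qb ≤ d` and everything nonnegative, conclude
`qb·fa ≤ qa·fb`. [folklore] -/
theorem transfer_arith {d q a b f qb qa fb fa : ℝ} (hd : 0 ≤ d) (hq : 0 ≤ q) (hb : 0 ≤ b)
    (hf : 0 ≤ f) (hqa : 0 ≤ qa) (hfb : 0 ≤ fb) (hfa : 0 ≤ fa) (hqbd : qb ≤ d)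
    (h1 : d * qb ≤ q * b) (h2 : q * a ≤ d * qa) (h3 : f * b ≤ d * fb) (h4 : d * fa ≤ a * f) :
    qb * fa ≤ qa * fb := by
  by_cases hd0 : d = 0
  · have hqb : qb ≤ 0 := by simpa [hd0] using hqbd
    nlinarith [mul_nonneg hqa hfb]
  have hdpos : 0 < d := lt_of_le_of_ne hd (Ne.symm hd0)
  have h14 : (d * qb) * (d * fa) ≤ (q * b) * (a * f) :=
    mul_le_mul h1 h4 (mul_nonneg hd hfa) (mul_nonneg hq hb)
  have h23 : (q * a) * (f * b) ≤ (d * qa) * (d * fb) :=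
    mul_le_mul h2 h3 (mul_nonneg hf hb) (mul_nonneg hd hqa)
  have key : d * d * (qb * fa) ≤ d * d * (qa * fb) := by nlinarith [h14, h23]
  exact le_of_mul_le_mul_left key (mul_pos hdpos hdpos)

/-- **The four-term transfer inequality.**  `D = {s ↮ X}` (`s ∉ X`); `Q`, `A'` predicates of `(C_s, ω ∖ C̄_s)`
decreasing in `C_s` and increasing off `C̄_s`; `B`, `F` increasing in `C_s` and decreasing off `C̄_s`.  Then
`μ(D ∩ Q ∩ B) · μ(D ∩ F ∩ A') ≤ μ(D ∩ Q ∩ A') · μ(D ∩ F ∩ B)`.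
Proof: on `D`, `Cov(Q,B) ≤ 0`, `Cov(Q,A') ≥ 0`, `Cov(F,B) ≥ 0`, `Cov(F,A') ≤ 0` (off-cluster association, BHK Thm 1.5
given `{s ↮ X}`), and `transfer_arith`. [cite: VandenbergHaggstromKahn2005, Thms. 1.3–1.5 (pp. 6–8)]
[cite: KozmaNitzan2024, Lemma 3 (pp. 6–7)] -/
theorem ratio_transfer (w : Sym2 V → unitInterval) (s : V) (X : Set V) (hs : s ∉ X)
    (Q A' B F : Set (Sym2 V) → Set (Sym2 V) → Prop)
    (hQ1 : ∀ ⦃C C'⦄ (E), C ⊆ C' → Q C' E → Q C E) (hQ2 : ∀ (C) ⦃E E'⦄, E ⊆ E' → Q C E → Q C E')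
    (hA1 : ∀ ⦃C C'⦄ (E), C ⊆ C' → A' C' E → A' C E) (hA2 : ∀ (C) ⦃E E'⦄, E ⊆ E' → A' C E → A' C E')
    (hB1 : ∀ ⦃C C'⦄ (E), C ⊆ C' → B C E → B C' E) (hB2 : ∀ (C) ⦃E E'⦄, E ⊆ E' → B C E' → B C E)
    (hF1 : ∀ ⦃C C'⦄ (E), C ⊆ C' → F C E → F C' E) (hF2 : ∀ (C) ⦃E E'⦄, E ⊆ E' → F C E' → F C E) :
    (prodBernoulli w).real (D⟦s, X⟧ ∩ {ω | Q (openEdgeCluster ω s) (ω \ B⟦openEdgeCluster ω s, s⟧)} ∩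
        {ω | B (openEdgeCluster ω s) (ω \ B⟦openEdgeCluster ω s, s⟧)}) *
      (prodBernoulli w).real (D⟦s, X⟧ ∩ {ω | F (openEdgeCluster ω s) (ω \ B⟦openEdgeCluster ω s, s⟧)} ∩
        {ω | A' (openEdgeCluster ω s) (ω \ B⟦openEdgeCluster ω s, s⟧)}) ≤
    (prodBernoulli w).real (D⟦s, X⟧ ∩ {ω | Q (openEdgeCluster ω s) (ω \ B⟦openEdgeCluster ω s, s⟧)} ∩
        {ω | A' (openEdgeCluster ω s) (ω \ B⟦openEdgeCluster ω s, s⟧)}) *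
      (prodBernoulli w).real (D⟦s, X⟧ ∩ {ω | F (openEdgeCluster ω s) (ω \ B⟦openEdgeCluster ω s, s⟧)} ∩
        {ω | B (openEdgeCluster ω s) (ω \ B⟦openEdgeCluster ω s, s⟧)}) := by
  set μ := prodBernoulli w with hμ
  -- (1) `Cov(Q, B) ≤ 0`
  have h1 := OffCluster.offCluster_event_negCorr w s X hs Q B hQ1 hQ2 hB1 hB2
  -- (2) `Cov(Q, A') ≥ 0`
  have h2 := OffCluster.offCluster_event_posAssoc w s X hs Q A' hQ1 hQ2 hA1 hA2
  -- (3) `Cov(F, B) ≥ 0`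
  have h3 := offCluster_event_posAssoc_cluster w s X hs F B hF1 hF2 hB1 hB2
  -- (4) `Cov(A', F) ≤ 0`
  have h4 := OffCluster.offCluster_event_negCorr w s X hs A' F hA1 hA2 hF1 hF2
  simp only [← inter_assoc] at h1 h2 h3 h4
  have e4 : D⟦s, X⟧ ∩ {ω | A' (openEdgeCluster ω s) (ω \ B⟦openEdgeCluster ω s, s⟧)} ∩
      {ω | F (openEdgeCluster ω s) (ω \ B⟦openEdgeCluster ω s, s⟧)} =
      D⟦s, X⟧ ∩ {ω | F (openEdgeCluster ω s) (ω \ B⟦openEdgeCluster ω s, s⟧)} ∩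
      {ω | A' (openEdgeCluster ω s) (ω \ B⟦openEdgeCluster ω s, s⟧)} := inter_right_comm _ _ _
  rw [e4] at h4
  refine transfer_arith measureReal_nonneg measureReal_nonneg measureReal_nonneg
    measureReal_nonneg measureReal_nonneg measureReal_nonneg measureReal_nonneg ?_ h1 h2 h3 h4
  exact measureReal_mono (inter_subset_left.trans inter_subset_left) (measure_ne_top _ _)

/-! ### The instance for connection events -/

omit [Fintype V] in
/-- On `{s ↮ x}`, `x ↔ y` in `ω` iff `x ↔ y` off `C̄_s` (restatement of `OffCluster.reachable_off_iff` with the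
disconnection hypothesis in the orientation of `D = {s ↮ X}`). [cite: VandenbergHaggstromKahn2005, §1 p. 8] -/
theorem reachable_off_iff' {ω : Set (Sym2 V)} {s x : V} (hx : ¬ (openGraph ω).Reachable s x) (y : V) :
    (openGraph ω).Reachable x y ↔ (openGraph (ω \ B⟦openEdgeCluster ω s, s⟧)).Reachable x y :=
  OffCluster.reachable_off_iff (fun h => hx h.symm) y

/-- **The four-term transfer for connection events.**  Vertices `o, a, c, b`, a set `X` with `o ∈ X`, `c ∉ X`,
`D = {c ↮ X}`, and ANY decreasing predicate `Φ` of a configuration (applied to the configuration off `C̄_c`):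
`μ(D ∩ {o↔a} ∩ {c↔b}) · μ(D ∩ {Φ} ∩ ({a↔b} ∩ {a↮c})) ≤ μ(D ∩ {o↔a} ∩ ({a↔b} ∩ {a↮c})) · μ(D ∩ {Φ} ∩ {c↔b})`.
(`{o↔a} ∩ {o↮c}` and `{a↔b} ∩ {a↮c}` are off-increasing, `{c↔b}` is cluster-increasing, `Φ(ω ∖ C̄_c)` is
off-decreasing; on `D` the guards `o↮c`, `a↮c` are automatic.) [cite: VandenbergHaggstromKahn2005, Thms. 1.3–1.5 (pp. 6–8)] -/
theorem ratio_transfer_conn (w : Sym2 V → unitInterval) (o a c b : V) (X : Set V) (hoX : o ∈ X) (hcX : c ∉ X) (Φ : Set (Sym2 V) → Prop) (hΦ : ∀ ⦃E E' : Set (Sym2 V)⦄, E ⊆ E' → Φ E' → Φ E) :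
    (prodBernoulli w).real (D⟦c, X⟧ ∩ openConn o a ∩ openConn c b) *
      (prodBernoulli w).real (D⟦c, X⟧ ∩ {ω | Φ (ω \ B⟦openEdgeCluster ω c, c⟧)} ∩
        (openConn a b ∩ (openConn a c)ᶜ)) ≤
    (prodBernoulli w).real (D⟦c, X⟧ ∩ openConn o a ∩ (openConn a b ∩ (openConn a c)ᶜ)) *
      (prodBernoulli w).real (D⟦c, X⟧ ∩ {ω | Φ (ω \ B⟦openEdgeCluster ω c, c⟧)} ∩ openConn c b) := by
  set μ := prodBernoulli w with hμ
  have key := ratio_transfer w c X hcX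
    (fun C E => (openGraph E).Reachable o a ∧ ¬ (o = c ∨ ∃ e ∈ C, o ∈ e))
    (fun C E => (openGraph E).Reachable a b ∧ ¬ (a = c ∨ ∃ e ∈ C, a ∈ e))
    (fun C _ => b = c ∨ ∃ e ∈ C, b ∈ e)
    (fun _ E => Φ E)
    (fun _ _ _ hCC' h => ⟨h.1, fun h' => h.2 (h'.imp id fun ⟨e, he, hxe⟩ => ⟨e, hCC' he, hxe⟩)⟩)
    (fun _ _ _ hEE' h => ⟨h.1.mono (openGraph_le hEE'), h.2⟩)
    (fun _ _ _ hCC' h => ⟨h.1, fun h' => h.2 (h'.imp id fun ⟨e, he, hxe⟩ => ⟨e, hCC' he, hxe⟩)⟩)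
    (fun _ _ _ hEE' h => ⟨h.1.mono (openGraph_le hEE'), h.2⟩)
    (fun _ _ _ hCC' h => h.imp id fun ⟨e, he, hze⟩ => ⟨e, hCC' he, hze⟩) (fun _ _ _ _ h => h)
    (fun _ _ _ _ h => h) (fun _ _ _ hEE' h => hΦ hEE' h)
  -- identify the events
  have eQ : {ω : BondConfig V | (openGraph (ω \ B⟦openEdgeCluster ω c, c⟧)).Reachable o a ∧
      ¬ (o = c ∨ ∃ e ∈ openEdgeCluster ω c, o ∈ e)} = openConn o a ∩ (openConn o c)ᶜ :=
    (OffCluster.openConn_inter_compl_eq c o a).symm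
  have eA : {ω : BondConfig V | (openGraph (ω \ B⟦openEdgeCluster ω c, c⟧)).Reachable a b ∧
      ¬ (a = c ∨ ∃ e ∈ openEdgeCluster ω c, a ∈ e)} = openConn a b ∩ (openConn a c)ᶜ :=
    (OffCluster.openConn_inter_compl_eq c a b).symm
  have eB : {ω : BondConfig V | b = c ∨ ∃ e ∈ openEdgeCluster ω c, b ∈ e} = openConn c b :=
    (OffCluster.openConn_eq_setOf c b).symm
  simp only [eQ, eA, eB] at key
  -- on `D`, `{o↔a} ∩ {o↮c} = {o↔a}`
  have eD : D⟦c, X⟧ ∩ (openConn o a ∩ (openConn o c)ᶜ) = D⟦c, X⟧ ∩ openConn o a := by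
    ext ω
    simp only [mem_inter_iff, mem_setOf_eq, mem_compl_iff, openConn]
    constructor
    · rintro ⟨hD, hoa, -⟩; exact ⟨hD, hoa⟩
    · rintro ⟨hD, hoa⟩; exact ⟨hD, hoa, fun h => hD o hoX h.symm⟩
  rw [eD] at key
  exact key

/-- **The four-term transfer with an avoided set for the observer.**  With `o ∈ X`, `c ∉ X`, `D = {c ↮ X}` and a vertex
set `Z`: `μ(D, o↔a, c↔b) · μ(D, o↮Z, a↔b, a↮c) ≤ μ(D, o↔a, a↔b, a↮c) · μ(D, o↮Z, c↔b)`
(`ratio_transfer_conn` with `Φ(E) = ∀ z ∈ Z, ¬ (o ↔ z in E)`; on `D`, `o ↔ z` iff `o ↔ z` off `C̄_c`).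
[cite: VandenbergHaggstromKahn2005, Thms. 1.3–1.5 (pp. 6–8)] [cite: KozmaNitzan2024, Questions 8–9 (p. 36)] -/
theorem ratio_transfer_avoid (w : Sym2 V → unitInterval) (o a c b : V) (X : Set V) (hoX : o ∈ X) (hcX : c ∉ X)
    (Z : Set V) :
    (prodBernoulli w).real (D⟦c, X⟧ ∩ openConn o a ∩ openConn c b) *
      (prodBernoulli w).real (D⟦c, X⟧ ∩ {ω | ∀ z ∈ Z, ¬ (openGraph ω).Reachable o z} ∩
        (openConn a b ∩ (openConn a c)ᶜ)) ≤
    (prodBernoulli w).real (D⟦c, X⟧ ∩ openConn o a ∩ (openConn a b ∩ (openConn a c)ᶜ)) *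
      (prodBernoulli w).real (D⟦c, X⟧ ∩ {ω | ∀ z ∈ Z, ¬ (openGraph ω).Reachable o z} ∩ openConn c b) := by
  have key := ratio_transfer_conn w o a c b X hoX hcX
    (fun E => ∀ z ∈ Z, ¬ (openGraph E).Reachable o z)
    (fun _ _ hEE' h z hz hr => h z hz (hr.mono (openGraph_le hEE')))
  have eF : D⟦c, X⟧ ∩ {ω : BondConfig V | ∀ z ∈ Z,
      ¬ (openGraph (ω \ B⟦openEdgeCluster ω c, c⟧)).Reachable o z} =
      D⟦c, X⟧ ∩ {ω | ∀ z ∈ Z, ¬ (openGraph ω).Reachable o z} := by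
    ext ω
    simp only [mem_inter_iff, mem_setOf_eq]
    constructor
    · rintro ⟨hD, h⟩
      exact ⟨hD, fun z hz hr => h z hz ((reachable_off_iff' (hD o hoX) z).1 hr)⟩
    · rintro ⟨hD, h⟩
      exact ⟨hD, fun z hz hr => h z hz ((reachable_off_iff' (hD o hoX) z).2 hr)⟩
  rw [eF] at key
  exact key

/-- **The four-term transfer for an arbitrary decreasing event `F = {Ψ}` of the configuration that, on `D = {c ↮ X}`,
only depends on the configuration off `C̄_c`** (e.g. any decreasing event determined by the cluster of `o ∈ X`:
`{o ↮ Z}`, `{o ↮ Z} ∩ {|C(o)| ≤ k}`, …): `μ(D, o↔a, c↔b) · μ(D, Ψ, a↔b, a↮c) ≤ μ(D, o↔a, a↔b, a↮c) · μ(D, Ψ, c↔b)`.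
[cite: VandenbergHaggstromKahn2005, Thms. 1.3–1.5 (pp. 6–8)] [cite: KozmaNitzan2024, Questions 8–9 (p. 36)] -/
theorem ratio_transfer_offDecreasing (w : Sym2 V → unitInterval) (o a c b : V) (X : Set V) (hoX : o ∈ X)
    (hcX : c ∉ X) (Ψ : Set (Sym2 V) → Prop) (hΨ : ∀ ⦃E E' : Set (Sym2 V)⦄, E ⊆ E' → Ψ E' → Ψ E)
    (hoff : ∀ ω : BondConfig V, (∀ x ∈ X, ¬ (openGraph ω).Reachable c x) →
      (Ψ ω ↔ Ψ (ω \ B⟦openEdgeCluster ω c, c⟧))) :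
    (prodBernoulli w).real (D⟦c, X⟧ ∩ openConn o a ∩ openConn c b) *
      (prodBernoulli w).real (D⟦c, X⟧ ∩ {ω | Ψ ω} ∩ (openConn a b ∩ (openConn a c)ᶜ)) ≤
    (prodBernoulli w).real (D⟦c, X⟧ ∩ openConn o a ∩ (openConn a b ∩ (openConn a c)ᶜ)) *
      (prodBernoulli w).real (D⟦c, X⟧ ∩ {ω | Ψ ω} ∩ openConn c b) := by
  have key := ratio_transfer_conn w o a c b X hoX hcX Ψ hΨ
  have eF : D⟦c, X⟧ ∩ {ω : BondConfig V | Ψ (ω \ B⟦openEdgeCluster ω c, c⟧)} = D⟦c, X⟧ ∩ {ω | Ψ ω} := by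
    ext ω
    simp only [mem_inter_iff, mem_setOf_eq]
    constructor
    · rintro ⟨hD, h⟩; exact ⟨hD, (hoff ω hD).2 h⟩
    · rintro ⟨hD, h⟩; exact ⟨hD, (hoff ω hD).1 h⟩
  rw [eF] at key
  exact key

end KnQ8Z

end Summit.CriticalPhenomena.PercolationContinuityZ3.Theorems
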